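import Summits.SmoothPoincare4.SmoothPoincare4.Theorems.CongruenceShadowsShadowApproximationStubLayerStepZeroTwoCalculus
import HarnessLib

/-!
# Helper VII (the IA Goeritz element `x₄ = ⁅z₀₂, w₀₁⁆`) for stub `stub_layerStepZeroTwo` of line
`nilpotent-genus-class`, crux `CongruenceShadows.ShadowApproximation` (item stmt-SmoothPoincare4-14595)

Genus `3`, notation of the siblings.  The commutator `x₄ = z₀₂ w₀₁ z₀₂⁻¹ w₀₁⁻¹ ∈ Aut S₃` of the landed explicit Goeritz
elements `z02` (inducing `moveZ 0 2 1` on `H₁`) and `w01` (inducing `moveW 0 1 1`) is a Goeritz element; since the two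
homology actions commute it is IA (`goeritz_of_decide` with the identity of `H₁`).  Its Johnson values are read off
the free words: `exists_x4` (Goeritz, IA, the free lift), `x4_values` (exact values / classes modulo `γ₃` at the cut
letters of `N₂`: `x₄(a₁)a₁⁻¹ = ⁅⁅b₂,a₀⁻¹⁆,a₁⁆ ∈ γ₃`, `x₄(b₀)b₀⁻¹ ≡ ⁅a₁,b₂⁆`, `x₄(a₂)a₂⁻¹ ≡ ⁅a₀,a₁⁆⁻¹` — explicit
factorisations in the free group `F₆`, checked by `decide`), `x4_pi` (the images of the values at `a₁, b₂, b₁` under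
the erasing projection `π` of `N₂`: `1, 1, y₁⁅y₀⁻¹,y₂⁆y₁⁻¹`, by `decide`), and the degree-one data
`θ₁(π(x₄(t)t⁻¹))` at `t = e₁₂(a₁), e₁₂(b₁)` (`x4_datum_P/Q`: `0` and `⁅-y₀, y₂⁆`).  No definitions, no notations.
-/

set_option linter.dupNamespace false

noncomputable section

open Subgroup Literature.Topology.FourManifolds Literature.Algebra.Lie Multiplicative
open Summit.SmoothPoincare4.SmoothPoincare4.Theorems.NilpotentShadowsStandard.SaturatedTorsorDescent
open Literature.GroupTheory.CombinatorialGroupTheory (commutator_mem_lcs_succ')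
open scoped commutatorElement

namespace Summit.SmoothPoincare4.SmoothPoincare4.Theorems.ShadowApproximation.NilpotentGenusClass

namespace LayerZeroTwo

open LayerZeroOne

/-- **The IA Goeritz element `x₄ = z₀₂ w₀₁ z₀₂⁻¹ w₀₁⁻¹`**: a Goeritz element of `S₃`, IA (the homology actions
`moveZ 0 2 1`, `moveW 0 1 1` commute), with free lift `z02 ∘ w01 ∘ z02⁻¹ ∘ w01⁻¹` on words. [folklore] -/
theorem exists_x4 : ∃ x : SurfaceGroup 3 ≃* SurfaceGroup 3,
    (s4Kernels 0).map x.toMonoidHom = s4Kernels 0 ∧ (s4Kernels 1).map x.toMonoidHom = s4Kernels 1 ∧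
    (∀ s, x s * s⁻¹ ∈ (⊤ : Subgroup (SurfaceGroup 3)).lowerCentralSeries 1) ∧
    ∀ l : surfaceGen 3, x (PresentedGroup.of l) = PresentedGroup.mk _ (z02.hom (w01.hom (z02.inv (w01.inv (FreeGroup.of l))))) := by
  obtain ⟨h0, h1, hr⟩ := goeritz_of_decide
    ((((⟨w01.inv, w01.hom, w01.inv_rel, w01.hom_rel, w01.hom_comp, w01.inv_comp⟩ : RelatorAut 3).trans
      (⟨z02.inv, z02.hom, z02.inv_rel, z02.hom_rel, z02.hom_comp, z02.inv_comp⟩ : RelatorAut 3)).trans w01).trans z02)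
    (LinearEquiv.refl ℤ (surfaceGen 3 → ℤ)) (by decide +kernel) (by decide +kernel) (by decide +kernel) (by decide +kernel) (by decide +kernel)
  refine ⟨_, h0, h1, fun s => mul_inv_mem_γ₂ (by rw [hr, LinearEquiv.refl_apply]), fun l => ?_⟩
  rw [relatorAut_of]
  rfl

/-- **The Johnson values of `x₄` at the cut letters of `N₂`** (from explicit factorisations of the free words,
checked by `decide`): `x₄(a₁)a₁⁻¹ = ⁅⁅b₂,a₀⁻¹⁆,a₁⁆`, `x₄(b₀)b₀⁻¹ ≡ ⁅a₁,b₂⁆` and `x₄(a₂)a₂⁻¹ ≡ ⁅a₁,a₀⁆` modulo `γ₃`.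
[folklore] -/
theorem x4_values (x : SurfaceGroup 3 ≃* SurfaceGroup 3)
    (hx : ∀ l : surfaceGen 3, x (PresentedGroup.of l) = PresentedGroup.mk _ (z02.hom (w01.hom (z02.inv (w01.inv (FreeGroup.of l)))))) :
    x (PresentedGroup.of ((1 : Fin 3), false)) * (PresentedGroup.of ((1 : Fin 3), false) : SurfaceGroup 3)⁻¹ = ⁅⁅(PresentedGroup.of ((2 : Fin 3), true) : SurfaceGroup 3), ((PresentedGroup.of ((0 : Fin 3), false) : SurfaceGroup 3))⁻¹⁆, (PresentedGroup.of ((1 : Fin 3), false) : SurfaceGroup 3)⁆ ∧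
    (((x (PresentedGroup.of ((0 : Fin 3), true)) * (PresentedGroup.of ((0 : Fin 3), true) : SurfaceGroup 3)⁻¹ : SurfaceGroup 3)) :
        SurfaceGroup 3 ⧸ (⊤ : Subgroup (SurfaceGroup 3)).lowerCentralSeries 2) = ((⁅(PresentedGroup.of ((1 : Fin 3), false) : SurfaceGroup 3), (PresentedGroup.of ((2 : Fin 3), true) : SurfaceGroup 3)⁆ : SurfaceGroup 3) : SurfaceGroup 3 ⧸ (⊤ : Subgroup (SurfaceGroup 3)).lowerCentralSeries 2) ∧
    (((x (PresentedGroup.of ((2 : Fin 3), false)) * (PresentedGroup.of ((2 : Fin 3), false) : SurfaceGroup 3)⁻¹ : SurfaceGroup 3)) :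
        SurfaceGroup 3 ⧸ (⊤ : Subgroup (SurfaceGroup 3)).lowerCentralSeries 2) = ((⁅(PresentedGroup.of ((1 : Fin 3), false) : SurfaceGroup 3), (PresentedGroup.of ((0 : Fin 3), false) : SurfaceGroup 3)⁆ : SurfaceGroup 3) : SurfaceGroup 3 ⧸ (⊤ : Subgroup (SurfaceGroup 3)).lowerCentralSeries 2) := by
  have key : ∀ (l : surfaceGen 3) (w : FreeGroup (surfaceGen 3)),
      z02.hom (w01.hom (z02.inv (w01.inv (FreeGroup.of l)))) * (FreeGroup.of l)⁻¹ = w →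
      x (PresentedGroup.of l) * (PresentedGroup.of l : SurfaceGroup 3)⁻¹ = PresentedGroup.mk _ w := fun l w h => by
    rw [hx, show (PresentedGroup.of l : SurfaceGroup 3) = PresentedGroup.mk _ (FreeGroup.of l) from rfl, ← map_inv, ← map_mul, h]
  refine ⟨?_, ?_, ?_⟩
  · rw [key ((1 : Fin 3), false) (⁅⁅FreeGroup.of ((2 : Fin 3), true), (FreeGroup.of ((0 : Fin 3), false))⁻¹⁆, FreeGroup.of ((1 : Fin 3), false)⁆) (by decide +kernel)]
    simp only [map_commutatorElement, map_inv]
    rfl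
  · have e := key ((0 : Fin 3), true) ((⁅(⁅(FreeGroup.of ((2 : Fin 3), true))⁻¹, (FreeGroup.of ((0 : Fin 3), false) * FreeGroup.of ((1 : Fin 3), false) * (FreeGroup.of ((0 : Fin 3), false))⁻¹)⁆)⁻¹, (FreeGroup.of ((0 : Fin 3), false))⁻¹⁆ * ⁅FreeGroup.of ((0 : Fin 3), true), ⁅(FreeGroup.of ((2 : Fin 3), true))⁻¹, (FreeGroup.of ((0 : Fin 3), false) * FreeGroup.of ((1 : Fin 3), false) * (FreeGroup.of ((0 : Fin 3), false))⁻¹)⁆⁆ * ⁅(FreeGroup.of ((2 : Fin 3), true))⁻¹, ⁅FreeGroup.of ((0 : Fin 3), false), FreeGroup.of ((1 : Fin 3), false)⁆⁆ * (⁅FreeGroup.of ((0 : Fin 3), false), FreeGroup.of ((1 : Fin 3), false)⁆ * ⁅(FreeGroup.of ((2 : Fin 3), true))⁻¹, ⁅FreeGroup.of ((1 : Fin 3), false), FreeGroup.of ((2 : Fin 3), true)⁆⁆ * (⁅FreeGroup.of ((0 : Fin 3), false), FreeGroup.of ((1 : Fin 3), false)⁆)⁻¹) * ⁅⁅FreeGroup.of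 ((0 : Fin 3), false), FreeGroup.of ((1 : Fin 3), false)⁆, ⁅FreeGroup.of ((1 : Fin 3), false), FreeGroup.of ((2 : Fin 3), true)⁆⁆) * ⁅FreeGroup.of ((1 : Fin 3), false), FreeGroup.of ((2 : Fin 3), true)⁆) (by decide +kernel)
    have hZ : (PresentedGroup.mk ({surfaceRelator 3} : Set (FreeGroup (surfaceGen 3))) ((⁅(⁅(FreeGroup.of ((2 : Fin 3), true))⁻¹, (FreeGroup.of ((0 : Fin 3), false) * FreeGroup.of ((1 : Fin 3), false) * (FreeGroup.of ((0 : Fin 3), false))⁻¹)⁆)⁻¹, (FreeGroup.of ((0 : Fin 3), false))⁻¹⁆ * ⁅FreeGroup.of ((0 : Fin 3), true), ⁅(FreeGroup.of ((2 : Fin 3), true))⁻¹, (FreeGroup.of ((0 : Fin 3), false) * FreeGroup.of ((1 : Fin 3), false) * (FreeGroup.of ((0 : Fin 3), false))⁻¹)⁆⁆ * ⁅(FreeGroup.of ((2 : Fin 3), true))⁻¹, ⁅FreeGroup.of ((0 : Fin 3), false), FreeGroup.of ((1 : Fin 3), false)⁆⁆ * (⁅FreeGroup.of ((0 : Fin 3),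 false), FreeGroup.of ((1 : Fin 3), false)⁆ * ⁅(FreeGroup.of ((2 : Fin 3), true))⁻¹, ⁅FreeGroup.of ((1 : Fin 3), false), FreeGroup.of ((2 : Fin 3), true)⁆⁆ * (⁅FreeGroup.of ((0 : Fin 3), false), FreeGroup.of ((1 : Fin 3), false)⁆)⁻¹) * ⁅⁅FreeGroup.of ((0 : Fin 3), false), FreeGroup.of ((1 : Fin 3), false)⁆, ⁅FreeGroup.of ((1 : Fin 3), false), FreeGroup.of ((2 : Fin 3), true)⁆⁆)) : SurfaceGroup 3) ∈
        (⊤ : Subgroup (SurfaceGroup 3)).lowerCentralSeries 2 := by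
      simp only [map_commutatorElement, map_mul, map_inv]
      exact mul_mem (mul_mem (mul_mem (mul_mem (commutator_mem_commutator (inv_mem (commutator_mem_commutator (mem_top _) (mem_top _))) (mem_top _)) (commutator_mem_lcs_succ' _ (commutator_mem_commutator (mem_top _) (mem_top _)))) (commutator_mem_lcs_succ' _ (commutator_mem_commutator (mem_top _) (mem_top _)))) (Subgroup.Normal.conj_mem inferInstance _ (commutator_mem_lcs_succ' _ (commutator_mem_commutator (mem_top _) (mem_top _))) _)) (commutator_mem_commutator (commutator_mem_commutator (mem_top _) (mem_top _)) (mem_top _))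
    rw [e, map_mul, QuotientGroup.mk_mul, (QuotientGroup.eq_one_iff _).2 hZ, one_mul]
    simp only [map_commutatorElement]
    rfl
  · have e := key ((2 : Fin 3), false) ((⁅⁅FreeGroup.of ((2 : Fin 3), true), (FreeGroup.of ((0 : Fin 3), false))⁻¹⁆, (FreeGroup.of ((1 : Fin 3), false))⁻¹⁆ * ((FreeGroup.of ((1 : Fin 3), false))⁻¹ * ⁅(⁅(FreeGroup.of ((2 : Fin 3), true))⁻¹, (FreeGroup.of ((0 : Fin 3), false) * FreeGroup.of ((1 : Fin 3), false) * (FreeGroup.of ((0 : Fin 3), false))⁻¹)⁆)⁻¹, (FreeGroup.of ((0 : Fin 3), false))⁻¹⁆ * ((FreeGroup.of ((1 : Fin 3), false))⁻¹)⁻¹) * (FreeGroup.of ((2 : Fin 3), false) * ((⁅FreeGroup.of ((0 : Fin 3), false), (FreeGroup.of ((1 : Fin 3), false))⁻¹⁆ * ⁅(FreeGroup.of ((1 : Fin 3), false))⁻¹, ⁅FreeGroup.of ((2 : Fin 3), true), (FreeGroup.of ((0 : Fin 3), false))⁻¹⁆⁆ * (⁅FreeGroup.of ((0 : Fin 3),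 false), (FreeGroup.of ((1 : Fin 3), false))⁻¹⁆)⁻¹) * ((⁅FreeGroup.of ((0 : Fin 3), false), (FreeGroup.of ((1 : Fin 3), false))⁻¹⁆ * ⁅FreeGroup.of ((2 : Fin 3), true), (FreeGroup.of ((0 : Fin 3), false))⁻¹⁆) * ⁅((FreeGroup.of ((1 : Fin 3), false))⁻¹ * (FreeGroup.of ((0 : Fin 3), false))⁻¹), ⁅FreeGroup.of ((1 : Fin 3), false), FreeGroup.of ((0 : Fin 3), false)⁆⁆ * ((⁅FreeGroup.of ((0 : Fin 3), false), (FreeGroup.of ((1 : Fin 3), false))⁻¹⁆ * ⁅FreeGroup.of ((2 : Fin 3), true), (FreeGroup.of ((0 : Fin 3), false))⁻¹⁆))⁻¹) * ⁅(⁅FreeGroup.of ((0 : Fin 3), false), (FreeGroup.of ((1 : Fin 3), false))⁻¹⁆ * ⁅FreeGroup.of ((2 : Fin 3), true), (FreeGroup.of ((0 : Fin 3), false))⁻¹⁆), ⁅FreeGroup.of ((1 : Fin 3), false), FreeGroup.of ((0 : Fin 3), false)⁆⁆) * (FreeGroup.of ((2 : Fin 3), false))⁻¹) * ((FreeGroup.of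 ((2 : Fin 3), false) * ⁅FreeGroup.of ((1 : Fin 3), false), FreeGroup.of ((0 : Fin 3), false)⁆) * ⁅⁅FreeGroup.of ((0 : Fin 3), false), (FreeGroup.of ((1 : Fin 3), false))⁻¹⁆, (⁅FreeGroup.of ((2 : Fin 3), true), (FreeGroup.of ((0 : Fin 3), false))⁻¹⁆ * (FreeGroup.of ((0 : Fin 3), false))⁻¹)⁆ * ((FreeGroup.of ((2 : Fin 3), false) * ⁅FreeGroup.of ((1 : Fin 3), false), FreeGroup.of ((0 : Fin 3), false)⁆))⁻¹) * ⁅FreeGroup.of ((2 : Fin 3), false), ⁅FreeGroup.of ((1 : Fin 3), false), FreeGroup.of ((0 : Fin 3), false)⁆⁆) * ⁅FreeGroup.of ((1 : Fin 3), false), FreeGroup.of ((0 : Fin 3), false)⁆) (by decide +kernel)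
    have hZ : (PresentedGroup.mk ({surfaceRelator 3} : Set (FreeGroup (surfaceGen 3))) ((⁅⁅FreeGroup.of ((2 : Fin 3), true), (FreeGroup.of ((0 : Fin 3), false))⁻¹⁆, (FreeGroup.of ((1 : Fin 3), false))⁻¹⁆ * ((FreeGroup.of ((1 : Fin 3), false))⁻¹ * ⁅(⁅(FreeGroup.of ((2 : Fin 3), true))⁻¹, (FreeGroup.of ((0 : Fin 3), false) * FreeGroup.of ((1 : Fin 3), false) * (FreeGroup.of ((0 : Fin 3), false))⁻¹)⁆)⁻¹, (FreeGroup.of ((0 : Fin 3), false))⁻¹⁆ * ((FreeGroup.of ((1 : Fin 3), false))⁻¹)⁻¹) * (FreeGroup.of ((2 : Fin 3), false) * ((⁅FreeGroup.of ((0 : Fin 3), false), (FreeGroup.of ((1 : Fin 3), false))⁻¹⁆ * ⁅(FreeGroup.of ((1 : Fin 3), false))⁻¹, ⁅FreeGroup.of ((2 : Fin 3), true), (FreeGroup.of ((0 : Fin 3), false))⁻¹⁆⁆ * (⁅FreeGroup.of ((0 : Fin 3), false), (FreeGroup.of ((1 : Fin 3), false))⁻¹⁆)⁻¹) * ((⁅FreeGroup.of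 ((0 : Fin 3), false), (FreeGroup.of ((1 : Fin 3), false))⁻¹⁆ * ⁅FreeGroup.of ((2 : Fin 3), true), (FreeGroup.of ((0 : Fin 3), false))⁻¹⁆) * ⁅((FreeGroup.of ((1 : Fin 3), false))⁻¹ * (FreeGroup.of ((0 : Fin 3), false))⁻¹), ⁅FreeGroup.of ((1 : Fin 3), false), FreeGroup.of ((0 : Fin 3), false)⁆⁆ * ((⁅FreeGroup.of ((0 : Fin 3), false), (FreeGroup.of ((1 : Fin 3), false))⁻¹⁆ * ⁅FreeGroup.of ((2 : Fin 3), true), (FreeGroup.of ((0 : Fin 3), false))⁻¹⁆))⁻¹) * ⁅(⁅FreeGroup.of ((0 : Fin 3), false), (FreeGroup.of ((1 : Fin 3), false))⁻¹⁆ * ⁅FreeGroup.of ((2 : Fin 3), true), (FreeGroup.of ((0 : Fin 3), false))⁻¹⁆), ⁅FreeGroup.of ((1 : Fin 3), false), FreeGroup.of ((0 : Fin 3), false)⁆⁆) * (FreeGroup.of ((2 : Fin 3), false))⁻¹) * ((FreeGroup.of ((2 : Fin 3), false) * ⁅FreeGroup.of ((1 : Fin 3), false), FreeGroup.of ((0 :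 Fin 3), false)⁆) * ⁅⁅FreeGroup.of ((0 : Fin 3), false), (FreeGroup.of ((1 : Fin 3), false))⁻¹⁆, (⁅FreeGroup.of ((2 : Fin 3), true), (FreeGroup.of ((0 : Fin 3), false))⁻¹⁆ * (FreeGroup.of ((0 : Fin 3), false))⁻¹)⁆ * ((FreeGroup.of ((2 : Fin 3), false) * ⁅FreeGroup.of ((1 : Fin 3), false), FreeGroup.of ((0 : Fin 3), false)⁆))⁻¹) * ⁅FreeGroup.of ((2 : Fin 3), false), ⁅FreeGroup.of ((1 : Fin 3), false), FreeGroup.of ((0 : Fin 3), false)⁆⁆)) : SurfaceGroup 3) ∈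
        (⊤ : Subgroup (SurfaceGroup 3)).lowerCentralSeries 2 := by
      simp only [map_commutatorElement, map_mul, map_inv]
      exact mul_mem (mul_mem (mul_mem (mul_mem (commutator_mem_commutator (commutator_mem_commutator (mem_top _) (mem_top _)) (mem_top _)) (Subgroup.Normal.conj_mem inferInstance _ (commutator_mem_commutator (inv_mem (commutator_mem_commutator (mem_top _) (mem_top _))) (mem_top _)) _)) (Subgroup.Normal.conj_mem inferInstance _ (mul_mem (mul_mem (Subgroup.Normal.conj_mem inferInstance _ (commutator_mem_lcs_succ' _ (commutator_mem_commutator (mem_top _) (mem_top _))) _) (Subgroup.Normal.conj_mem inferInstance _ (commutator_mem_lcs_succ' _ (commutator_mem_commutator (mem_top _) (mem_top _))) _)) (commutator_mem_commutator (mul_mem (commutator_mem_commutator (mem_top _) (mem_top _)) (commutator_mem_commutator (mem_top _) (mem_top _))) (mem_top _))) _)) (Subgroup.Normal.conj_mem inferInstance _ (commutator_mem_commutator (commutator_mem_commutator (mem_top _) (mem_top _)) (mem_top _)) _)) (commutator_mem_lcs_succ' _ (commutator_mem_commutator (mem_top _) (mem_top _)))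
    rw [e, map_mul, QuotientGroup.mk_mul, (QuotientGroup.eq_one_iff _).2 hZ, one_mul]
    simp only [map_commutatorElement]
    rfl

/-- **The values of `x₄` at `a₁, b₂, b₁` under the erasing projection of `N₂`**: `1`, `1` and `y₁ ⁅y₀⁻¹, y₂⁆ y₁⁻¹`
(free-group computations, by `decide`). [folklore] -/
theorem x4_pi (x : SurfaceGroup 3 ≃* SurfaceGroup 3)
    (hx : ∀ l : surfaceGen 3, x (PresentedGroup.of l) = PresentedGroup.mk _ (z02.hom (w01.hom (z02.inv (w01.inv (FreeGroup.of l))))))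
    (π : SurfaceGroup 3 →* FreeGroup (Fin 3))
    (hπof : ∀ (h : Fin 3) (b : Bool), π (PresentedGroup.of (h, b)) = if b = (![true, false, false] : Fin 3 → Bool) h then 1 else FreeGroup.of h) :
    π (x (PresentedGroup.of ((1 : Fin 3), false)) * (PresentedGroup.of ((1 : Fin 3), false) : SurfaceGroup 3)⁻¹) = 1 ∧
    π (x (PresentedGroup.of ((2 : Fin 3), true)) * (PresentedGroup.of ((2 : Fin 3), true) : SurfaceGroup 3)⁻¹) = 1 ∧
    π (x (PresentedGroup.of ((1 : Fin 3), true)) * (PresentedGroup.of ((1 : Fin 3), true) : SurfaceGroup 3)⁻¹) =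
      FreeGroup.of (1 : Fin 3) * ⁅(FreeGroup.of (0 : Fin 3))⁻¹, FreeGroup.of (2 : Fin 3)⁆ * (FreeGroup.of (1 : Fin 3))⁻¹ := by
  have hπmk : ∀ w, π (PresentedGroup.mk _ w) = FreeGroup.lift
      (fun y : surfaceGen 3 => if y.2 = (![true, false, false] : Fin 3 → Bool) y.1 then (1 : FreeGroup (Fin 3)) else FreeGroup.of y.1) w := by
    intro w
    have e : π.comp (PresentedGroup.mk _) = FreeGroup.lift
        (fun y : surfaceGen 3 => if y.2 = (![true, false, false] : Fin 3 → Bool) y.1 then (1 : FreeGroup (Fin 3)) else FreeGroup.of y.1) :=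
      FreeGroup.ext_hom _ _ fun y => by
        obtain ⟨h, b⟩ := y
        rw [MonoidHom.comp_apply, FreeGroup.lift_apply_of]
        exact hπof h b
    exact DFunLike.congr_fun e w
  have key : ∀ l : surfaceGen 3, π (x (PresentedGroup.of l) * (PresentedGroup.of l : SurfaceGroup 3)⁻¹) = FreeGroup.lift
      (fun y : surfaceGen 3 => if y.2 = (![true, false, false] : Fin 3 → Bool) y.1 then (1 : FreeGroup (Fin 3)) else FreeGroup.of y.1)
      (z02.hom (w01.hom (z02.inv (w01.inv (FreeGroup.of l)))) * (FreeGroup.of l)⁻¹) := fun l => by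
    rw [hx, show (PresentedGroup.of l : SurfaceGroup 3) = PresentedGroup.mk _ (FreeGroup.of l) from rfl, ← map_inv, ← map_mul, hπmk]
  refine ⟨?_, ?_, ?_⟩
  · rw [key]; decide +kernel
  · rw [key]; decide +kernel
  · rw [key]; decide +kernel


/-! ## The degree-one data of `x₄` at `e₁₂(a₁)` and `e₁₂(b₁)` -/

section Symbols

variable (θ : ℕ → FreeGroup (Fin 3) → FreeLieAlgebra ℤ (Fin 3))
  (hadd : ∀ k, ∀ x ∈ (⊤ : Subgroup (FreeGroup (Fin 3))).lowerCentralSeries k,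
    ∀ y ∈ (⊤ : Subgroup (FreeGroup (Fin 3))).lowerCentralSeries k, θ k (x * y) = θ k x + θ k y)
  (hker : ∀ k, ∀ x ∈ (⊤ : Subgroup (FreeGroup (Fin 3))).lowerCentralSeries k,
    θ k x = 0 ↔ x ∈ (⊤ : Subgroup (FreeGroup (Fin 3))).lowerCentralSeries (k + 1))
  (hof : ∀ i : Fin 3, θ 0 (FreeGroup.of i) = FreeLieAlgebra.of ℤ i)
  (hbr : ∀ j k, ∀ x ∈ (⊤ : Subgroup (FreeGroup (Fin 3))).lowerCentralSeries j,
    ∀ y ∈ (⊤ : Subgroup (FreeGroup (Fin 3))).lowerCentralSeries k, θ (j + k + 1) ⁅x, y⁆ = ⁅θ j x, θ k y⁆)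
  (π : SurfaceGroup 3 →* FreeGroup (Fin 3))
  (hπof : ∀ (h : Fin 3) (b : Bool), π (PresentedGroup.of (h, b)) = if b = (![true, false, false] : Fin 3 → Bool) h then 1 else FreeGroup.of h)

include hadd hker hπof in
/-- **`θ₁(π(x₄(P)P⁻¹)) = 0` for `P = e₁₂(a₁) = a₁b₁⁻¹b₂b₁`** (IA-calculus modulo `γ₃` and the values of `x₄` at
`a₁, b₂, b₁` under `π`). [folklore] -/
theorem x4_datum_P (x : SurfaceGroup 3 ≃* SurfaceGroup 3)
    (hIA : ∀ s, x s * s⁻¹ ∈ (⊤ : Subgroup (SurfaceGroup 3)).lowerCentralSeries 1)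
    (hx : ∀ l : surfaceGen 3, x (PresentedGroup.of l) = PresentedGroup.mk _ (z02.hom (w01.hom (z02.inv (w01.inv (FreeGroup.of l)))))) :
    θ 1 (π (x (e12.toMulEquiv (PresentedGroup.of ((1 : Fin 3), false))) * (e12.toMulEquiv (PresentedGroup.of ((1 : Fin 3), false)))⁻¹)) = 0 := by
  obtain ⟨pa1, pb2, pb1⟩ := x4_pi x hx π hπof
  have hP : e12.toMulEquiv (PresentedGroup.of ((1 : Fin 3), false)) =
      (PresentedGroup.of ((1 : Fin 3), false) : SurfaceGroup 3) * (PresentedGroup.of ((1 : Fin 3), true) : SurfaceGroup 3)⁻¹ *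
        (PresentedGroup.of ((2 : Fin 3), true) : SurfaceGroup 3) * (PresentedGroup.of ((1 : Fin 3), true) : SurfaceGroup 3) := by
    have h1 : e12.hom (FreeGroup.of ((1 : Fin 3), false)) = FreeGroup.of ((1 : Fin 3), false) * (FreeGroup.of ((1 : Fin 3), true))⁻¹ *
        FreeGroup.of ((2 : Fin 3), true) * FreeGroup.of ((1 : Fin 3), true) := by decide +kernel
    rw [relatorAut_of, h1]
    simp only [map_mul, map_inv]
    rfl
  -- the class of `x(P)P⁻¹` modulo `γ₃`
  have hcl : (((x ((PresentedGroup.of ((1 : Fin 3), false) : SurfaceGroup 3) * (PresentedGroup.of ((1 : Fin 3), true) : SurfaceGroup 3)⁻¹ *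
        (PresentedGroup.of ((2 : Fin 3), true) : SurfaceGroup 3) * (PresentedGroup.of ((1 : Fin 3), true) : SurfaceGroup 3)) *
      ((PresentedGroup.of ((1 : Fin 3), false) : SurfaceGroup 3) * (PresentedGroup.of ((1 : Fin 3), true) : SurfaceGroup 3)⁻¹ *
        (PresentedGroup.of ((2 : Fin 3), true) : SurfaceGroup 3) * (PresentedGroup.of ((1 : Fin 3), true) : SurfaceGroup 3))⁻¹ : SurfaceGroup 3)) :
        SurfaceGroup 3 ⧸ (⊤ : Subgroup (SurfaceGroup 3)).lowerCentralSeries 2) =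
      ((x (PresentedGroup.of ((1 : Fin 3), false)) * (PresentedGroup.of ((1 : Fin 3), false) : SurfaceGroup 3)⁻¹ : SurfaceGroup 3) : SurfaceGroup 3 ⧸ _) *
      (((x (PresentedGroup.of ((1 : Fin 3), true)) * (PresentedGroup.of ((1 : Fin 3), true) : SurfaceGroup 3)⁻¹ : SurfaceGroup 3) : SurfaceGroup 3 ⧸ _))⁻¹ *
      ((x (PresentedGroup.of ((2 : Fin 3), true)) * (PresentedGroup.of ((2 : Fin 3), true) : SurfaceGroup 3)⁻¹ : SurfaceGroup 3) : SurfaceGroup 3 ⧸ _) *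
      ((x (PresentedGroup.of ((1 : Fin 3), true)) * (PresentedGroup.of ((1 : Fin 3), true) : SurfaceGroup 3)⁻¹ : SurfaceGroup 3) : SurfaceGroup 3 ⧸ _) := by
    rw [ia_quot_mul hIA, ia_quot_mul hIA, ia_quot_mul hIA, ia_quot_inv hIA]
  rw [← QuotientGroup.mk_inv, ← QuotientGroup.mk_mul, ← QuotientGroup.mk_mul, ← QuotientGroup.mk_mul] at hcl
  have m1 := fun s => FreeGroupGrLie.map_mem_lcs π (hIA s)
  rw [hP, theta_pi_congr θ hadd hker π 1 (mul_mem (mul_mem (mul_mem (hIA _) (inv_mem (hIA _))) (hIA _)) (hIA _)) hcl, map_mul, map_mul,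
    map_mul, hadd 1 _ (mul_mem (mul_mem (m1 _) (FreeGroupGrLie.map_mem_lcs π (inv_mem (hIA _)))) (m1 _)) _ (m1 _),
    hadd 1 _ (mul_mem (m1 _) (FreeGroupGrLie.map_mem_lcs π (inv_mem (hIA _)))) _ (m1 _),
    hadd 1 _ (m1 _) _ (FreeGroupGrLie.map_mem_lcs π (inv_mem (hIA _))), map_inv, theta_inv θ hadd 1 (m1 _), pa1, pb2,
    theta_one θ hadd, zero_add, add_zero, neg_add_cancel]

include hadd hker hof hbr hπof in
/-- **`θ₁(π(x₄(Q)Q⁻¹)) = ⁅-y₀, y₂⁆` for `Q = e₁₂(b₁) = b₁⁻¹b₂⁻¹b₁b₂b₁`** (IA-calculus modulo `γ₃` and the values of `x₄`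
at `b₂, b₁` under `π`). [folklore] -/
theorem x4_datum_Q (x : SurfaceGroup 3 ≃* SurfaceGroup 3)
    (hIA : ∀ s, x s * s⁻¹ ∈ (⊤ : Subgroup (SurfaceGroup 3)).lowerCentralSeries 1)
    (hx : ∀ l : surfaceGen 3, x (PresentedGroup.of l) = PresentedGroup.mk _ (z02.hom (w01.hom (z02.inv (w01.inv (FreeGroup.of l)))))) :
    θ 1 (π (x (e12.toMulEquiv (PresentedGroup.of ((1 : Fin 3), true))) * (e12.toMulEquiv (PresentedGroup.of ((1 : Fin 3), true)))⁻¹)) =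
      ⁅-FreeLieAlgebra.of ℤ (0 : Fin 3), FreeLieAlgebra.of ℤ (2 : Fin 3)⁆ := by
  obtain ⟨-, pb2, pb1⟩ := x4_pi x hx π hπof
  have hQ : e12.toMulEquiv (PresentedGroup.of ((1 : Fin 3), true)) =
      (PresentedGroup.of ((1 : Fin 3), true) : SurfaceGroup 3)⁻¹ * (PresentedGroup.of ((2 : Fin 3), true) : SurfaceGroup 3)⁻¹ *
        (PresentedGroup.of ((1 : Fin 3), true) : SurfaceGroup 3) * (PresentedGroup.of ((2 : Fin 3), true) : SurfaceGroup 3) *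
        (PresentedGroup.of ((1 : Fin 3), true) : SurfaceGroup 3) := by
    have h1 : e12.hom (FreeGroup.of ((1 : Fin 3), true)) = (FreeGroup.of ((1 : Fin 3), true))⁻¹ * (FreeGroup.of ((2 : Fin 3), true))⁻¹ *
        FreeGroup.of ((1 : Fin 3), true) * FreeGroup.of ((2 : Fin 3), true) * FreeGroup.of ((1 : Fin 3), true) := by decide +kernel
    rw [relatorAut_of, h1]
    simp only [map_mul, map_inv]
    rfl
  have hcl : (((x ((PresentedGroup.of ((1 : Fin 3), true) : SurfaceGroup 3)⁻¹ * (PresentedGroup.of ((2 : Fin 3), true) : SurfaceGroup 3)⁻¹ *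
        (PresentedGroup.of ((1 : Fin 3), true) : SurfaceGroup 3) * (PresentedGroup.of ((2 : Fin 3), true) : SurfaceGroup 3) *
        (PresentedGroup.of ((1 : Fin 3), true) : SurfaceGroup 3)) *
      ((PresentedGroup.of ((1 : Fin 3), true) : SurfaceGroup 3)⁻¹ * (PresentedGroup.of ((2 : Fin 3), true) : SurfaceGroup 3)⁻¹ *
        (PresentedGroup.of ((1 : Fin 3), true) : SurfaceGroup 3) * (PresentedGroup.of ((2 : Fin 3), true) : SurfaceGroup 3) *
        (PresentedGroup.of ((1 : Fin 3), true) : SurfaceGroup 3))⁻¹ : SurfaceGroup 3)) :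
        SurfaceGroup 3 ⧸ (⊤ : Subgroup (SurfaceGroup 3)).lowerCentralSeries 2) =
      (((x (PresentedGroup.of ((1 : Fin 3), true)) * (PresentedGroup.of ((1 : Fin 3), true) : SurfaceGroup 3)⁻¹ : SurfaceGroup 3) : SurfaceGroup 3 ⧸ _))⁻¹ *
      (((x (PresentedGroup.of ((2 : Fin 3), true)) * (PresentedGroup.of ((2 : Fin 3), true) : SurfaceGroup 3)⁻¹ : SurfaceGroup 3) : SurfaceGroup 3 ⧸ _))⁻¹ *
      ((x (PresentedGroup.of ((1 : Fin 3), true)) * (PresentedGroup.of ((1 : Fin 3), true) : SurfaceGroup 3)⁻¹ : SurfaceGroup 3) : SurfaceGroup 3 ⧸ _) *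
      ((x (PresentedGroup.of ((2 : Fin 3), true)) * (PresentedGroup.of ((2 : Fin 3), true) : SurfaceGroup 3)⁻¹ : SurfaceGroup 3) : SurfaceGroup 3 ⧸ _) *
      ((x (PresentedGroup.of ((1 : Fin 3), true)) * (PresentedGroup.of ((1 : Fin 3), true) : SurfaceGroup 3)⁻¹ : SurfaceGroup 3) : SurfaceGroup 3 ⧸ _) := by
    rw [ia_quot_mul hIA, ia_quot_mul hIA, ia_quot_mul hIA, ia_quot_mul hIA, ia_quot_inv hIA, ia_quot_inv hIA]
  rw [← QuotientGroup.mk_inv, ← QuotientGroup.mk_inv, ← QuotientGroup.mk_mul, ← QuotientGroup.mk_mul, ← QuotientGroup.mk_mul,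
    ← QuotientGroup.mk_mul] at hcl
  have m1 := fun s => FreeGroupGrLie.map_mem_lcs π (hIA s)
  have m1' := fun s => FreeGroupGrLie.map_mem_lcs π (inv_mem (hIA s))
  rw [hQ, theta_pi_congr θ hadd hker π 1 (mul_mem (mul_mem (mul_mem (mul_mem (inv_mem (hIA _)) (inv_mem (hIA _))) (hIA _)) (hIA _)) (hIA _)) hcl,
    map_mul, map_mul, map_mul, map_mul,
    hadd 1 _ (mul_mem (mul_mem (mul_mem (m1' _) (m1' _)) (m1 _)) (m1 _)) _ (m1 _),
    hadd 1 _ (mul_mem (mul_mem (m1' _) (m1' _)) (m1 _)) _ (m1 _),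
    hadd 1 _ (mul_mem (m1' _) (m1' _)) _ (m1 _),
    hadd 1 _ (m1' _) _ (m1' _), map_inv, map_inv, theta_inv θ hadd 1 (m1 _), theta_inv θ hadd 1 (m1 _), pb2, pb1,
    theta_one θ hadd, neg_zero, add_zero, add_zero, neg_add_cancel, zero_add]
  -- `θ₁(y₁ ⁅y₀⁻¹, y₂⁆ y₁⁻¹) = ⁅-y₀, y₂⁆`
  have hc : ⁅(FreeGroup.of (0 : Fin 3))⁻¹, FreeGroup.of (2 : Fin 3)⁆ ∈ (⊤ : Subgroup (FreeGroup (Fin 3))).lowerCentralSeries 1 :=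
    commutator_mem_commutator (mem_top _) (mem_top _)
  have e : FreeGroup.of (1 : Fin 3) * ⁅(FreeGroup.of (0 : Fin 3))⁻¹, FreeGroup.of (2 : Fin 3)⁆ * (FreeGroup.of (1 : Fin 3))⁻¹ =
      ⁅FreeGroup.of (1 : Fin 3), ⁅(FreeGroup.of (0 : Fin 3))⁻¹, FreeGroup.of (2 : Fin 3)⁆⁆ * ⁅(FreeGroup.of (0 : Fin 3))⁻¹, FreeGroup.of (2 : Fin 3)⁆ := by
    simp only [commutatorElement_def]; group
  have e2 := hbr 0 0 (FreeGroup.of (0 : Fin 3))⁻¹ (mem_top _) (FreeGroup.of (2 : Fin 3)) (mem_top _)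
  rw [show (0 + 0 + 1 : ℕ) = 1 from rfl] at e2
  rw [e, theta_mul_of_mem_succ θ hadd hker 1 (commutator_mem_lcs_succ' _ hc) hc, e2, theta_inv θ hadd 0 (mem_top _), hof, hof]

end Symbols

end LayerZeroTwo



/-- **Registered helper `helper_layerZeroTwoXFour`** (sub-goal of stub `stub_layerStepZeroTwo`, item
stmt-SmoothPoincare4-14595): the IA Goeritz element `x₄ = z₀₂ w₀₁ z₀₂⁻¹ w₀₁⁻¹` with its free lift, in closed form.
[folklore] -/
theorem helper_layerZeroTwoXFour : ∃ x : Literature.Topology.FourManifolds.SurfaceGroup 3 ≃* Literature.Topology.FourManifolds.SurfaceGroup 3, (Literature.Topology.FourManifolds.s4Kernels 0).map x.toMonoidHom = Literature.Topology.FourManifolds.s4Kernels 0 ∧ (Literature.Topology.FourManifolds.s4Kernels 1).map x.toMonoidHom = Literature.Topology.FourManifolds.s4Kernels 1 ∧ (∀ s : Literature.Topology.FourManifolds.SurfaceGroup 3, x s * s⁻¹ ∈ (⊤ : Subgroup (Literature.Topology.FourManifolds.SurfaceGroup 3)).lowerCentralSeries 1) ∧ ∀ l : Literature.Topology.FourManifolds.surfaceGen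 3, x (PresentedGroup.of l) = PresentedGroup.mk _ (Summit.SmoothPoincare4.SmoothPoincare4.Theorems.ShadowApproximation.NilpotentGenusClass.z02.hom (Summit.SmoothPoincare4.SmoothPoincare4.Theorems.ShadowApproximation.NilpotentGenusClass.w01.hom (Summit.SmoothPoincare4.SmoothPoincare4.Theorems.ShadowApproximation.NilpotentGenusClass.z02.inv (Summit.SmoothPoincare4.SmoothPoincare4.Theorems.ShadowApproximation.NilpotentGenusClass.w01.inv (FreeGroup.of l))))) :=
  LayerZeroTwo.exists_x4

end Summit.SmoothPoincare4.SmoothPoincare4.Theorems.ShadowApproximation.NilpotentGenusClass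

end
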